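/-
Copyright: the b2b-balaban T⁴-continuum CRUX team, row NE7b OWNER lineage `t4-ne7b-p1` (gen 124). Project licence.
-/
import Summits.QuantumFields.BalabanUV.T4Continuum.Spine.NE7b.SupZdPerturbedCoarseEntries

/-!
# THE PERTURBED GREEN'S FUNCTION IS LIPSCHITZ IN `K` ON `ℤ^d`: for `V : ℤ^d → [−λ, Λ]` (`d ≥ 3`, every mesh), a kernel
# `|K(p,q)| ≤ εe^{−γ|p − q|₁}` under the two smallness conditions of (215)∕(216), and every source of exponential block PROFILE
# `|f(p)| ≤ M_fe^{−μ|blk n p − b₀|₁}`: the bounded solutions `u = Gf` of `H_Vu = f` and `u^K = G_Kf` of `(H_V + K)u^K = f` exist, are unique, keep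
# the profile (`2C_PK_{δ₀−μ}M_f`), and `|u^K − u| ≤ 4C_PK_{δ₀−μ}θM_f·e^{−μ|blk n p − b₀|₁}` pointwise and for block means, `θ = C_PK_{δ₀−μ}εe^{μd}K_{γ−μ}
# ∝ ε` — (216) (iii) from block indicators to profile sources (the input the fluctuation covariance's Lipschitz dependence on `K` needs);
# (216) §1 and (215)'s kernel step BY NAME (row NE7b, node U5c; [folklore])

Cell `pub-balaban`, sub-cell `t4`, spine estimate NE7b (`T4WeightBudget.RelWeightBound`; the cell's OWN estimate — NOT PRINTED in
[Bałaban 1983–89], NOT PROVED).  Crux-route work under `Spine/NE7b/` by the row OWNER (`t4-ne7b-p1` gen 124, file (224)) under FREEZE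
(0)'s crux-prover clause; NOTHING of Bałaban's is named as a Lean object, valued or asserted; no `T4Continuum/Support` leaf typed; no `def`,
no notation (`G`, `G_K` appear only through (216) §1's exported operators; `θ`, `C_PK_{δ₀−μ}` WRITTEN OUT); zero `sorry`.  Imports (BY NAME):
the OWNER's (216) `…SupZdPerturbedCoarseEntries` (`zd_perturbed_profile`; through it (215) `kernel_profile_step`, (48) `abs_apply_le_norm`,
(27) `mem_B`, `sum_B_const`), Mathlib's `Summable.tsum_sub`, `memℓp_infty`.

WHY (located).  § [NE7bP1-G124-HANDOFF] NEXT (3)(b): Lipschitz dependence on `K` of the column.  (216) (iii) proved `|Ψ^K − Ψ| = O(ε)` for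
the block INDICATOR sources; the fluctuation covariance ((221)) acts on general block sources `f` and its response part is built from
block means, so the comparison `C_Kf − Cf` starts from `G_Kf − Gf` for general `f` — this file — and continues with (223) (`h^K − h`) and
(216) (iii) (block means).  The proof is (216) (iii)'s, verbatim for profile sources: both `u` and `u^K` have the profile `2C_PK_{δ₀−μ}M_f`
((216) §1 with the zero kernel and with `K`), `u^K − u` is a bounded solution of the perturbed equation with source `−Ku`, whose profile is
`εe^{μd}K_{γ−μ}·2C_PK_{δ₀−μ}M_f` ((215)'s kernel step), and (216) §1 returns the profile with one more factor `2C_PK_{δ₀−μ}`.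

WHAT IS PROVED ([folklore]): §1 **`zd_perturbed_solution_lipschitz`** (THE END: `∃ C₀ C_P δ₀ > 0`: for ALL `n, V, ε, γ, μ` with the two
smallness conditions, every `K` of the class and every profile source: (i) existence + uniqueness of bounded `u`, `u^K`; (ii)∕(iii) for
every bounded solutions: both profiles, the `O(ε)` bound on `u^K − u` pointwise and for block means); §2 toy.

HONEST (what this is NOT).  Solutions only: the covariance comparison `C_Kf − Cf` (one more layer: (223) + block means) is the sequel; no
operator-norm statement (`‖G_K − G‖_{ℓ^∞→ℓ^∞} = O(ε)` is immediate from (213) but not the point here); THREE∕TWO smallness conditions with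
the sup road's constants — NOT (163)'s energy threshold; the LINEAR column only; `d ≥ 3` only; scalar skeleton ((A3), NC-NE7b-α UNRULED);
nothing of the covariant propagators of [B4]–[B6]; nothing of Bałaban's asserted.  BY-NAME EFFECT ON THE WALL: NONE.  NE7b NOT PRINTED ∕
NOT PROVED; spine PROVED 0∕9; rung (B)+1 — the programme's measures remain FINITE-torus statements; NOT the mass gap, NOT Clay.  HONEST
DEPENDENCY: continuum YM on T⁴ ⇐ BetaPertH ∧ nine spine estimates (0∕9 proved); BetaPertH ⇐ (D1) ∧ (D4) ∧ CAP+tail; G-an2-4 gates asym,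
D1 and NE2∕3∕4.
-/

set_option autoImplicit false

noncomputable section

namespace Summit.QuantumFields.BalabanUV.T4Continuum.NE7b.SupZdPerturbedSolutionLipschitz

open Real Filter Topology
open scoped ENNReal
open Literature.MathematicalPhysics.QuantumFieldTheory.Balaban1983to89
open B6QGQLower276 (X e blk B mem_B sum_B_const)
open SupZdPerturbedDecay (kernel_profile_step)
open SupZdPerturbedCoarseEntries (zd_perturbed_profile)
open OneShotChartSupOperator (abs_apply_le_norm)

variable {d : ℕ}

/-! ## §1. THE END: `G_K − G = O(ε)` on sources of exponential block profile, with the profile -/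

/-- **HEADLINE — THE PERTURBED GREEN'S FUNCTION IS LIPSCHITZ IN `K` ON PROFILE SOURCES**: `d ≥ 3`, `a > 0`, `λ < min(2,a)`, `Λ ≥ 0` ⟹
`∃ C₀ C_P δ₀ > 0` (from `(d, a, λ, Λ)` ONLY) such that for ALL `n`, `V : ℤ^d → [−λ, Λ]`, `ε ≥ 0`, `0 < μ < min(δ₀, γ)`, under the two
smallness conditions of (215)∕(216), every kernel `|K(p,q)| ≤ εe^{−γ|p−q|₁}` and every source of PROFILE `|f(p)| ≤ M_fe^{−μ|blk n p − b₀|₁}`: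
(i) the equations `H_Vu = f` and `(H_V + K)u^K = f` have bounded solutions (unique among bounded functions); (ii) every bounded solution of
either has the profile `2C_PK_{δ₀−μ}M_fe^{−μ|blk n p − b₀|₁}`, and so do its block means; (iii) for every bounded `u`, `u^K` as in (i):
`|u^K(p) − u(p)| ≤ 4C_PK_{δ₀−μ}θM_f·e^{−μ|blk n p − b₀|₁}` (`θ = C_PK_{δ₀−μ}εe^{μd}K_{γ−μ} ∝ ε`), and the same for the block means — (216) (iii)
from block indicators to PROFILE sources: `u^K − u` solves the perturbed equation with source `−Ku`, (215)'s kernel step, (216) §1. [folklore] -/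
theorem zd_perturbed_solution_lipschitz (hd : 3 ≤ d) (a : ℝ) (ha : 0 < a) {lam Lam : ℝ} (hlam : lam < min 2 a) (hLam : 0 ≤ Lam) :
    ∃ C₀ CP δ₀ : ℝ, 0 < C₀ ∧ 0 < CP ∧ 0 < δ₀ ∧ ∀ (n : ℕ) (V : X d → ℝ), (∀ p, -lam ≤ V p) → (∀ p, V p ≤ Lam) →
      ∀ (ε γ μ : ℝ), 0 ≤ ε → 0 < μ → μ < δ₀ → μ < γ →
      ε * (2 * (1 - exp (-γ))⁻¹) ^ d * C₀ ≤ 1 / 2 →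
      (CP * (2 * (1 - exp (-(δ₀ - μ)))⁻¹) ^ d) * (ε * exp (μ * d) * (2 * (1 - exp (-(γ - μ)))⁻¹) ^ d) ≤ 1 / 2 →
      ∀ (K : X d → X d → ℝ), (∀ p q, |K p q| ≤ ε * exp (-(γ * ∑ i, (((p i - q i).natAbs : ℕ) : ℝ)))) →
      ∀ (b₀ : X d) (Mf : ℝ) (f : X d → ℝ), (∀ p, |f p| ≤ Mf * exp (-(μ * ∑ i, (((blk n p i - b₀ i).natAbs : ℕ) : ℝ)))) →
        -- (i) existence and uniqueness of bounded solutions, unperturbed and perturbed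
        (∃ u : X d → ℝ, (∃ Bu : ℝ, ∀ p, |u p| ≤ Bu) ∧
          (∀ p, ((n : ℝ) + 1) ^ 2 * ∑ μ', (2 * u p - u (p + e μ') - u (p - e μ'))
            + a / ((n : ℝ) + 1) ^ d * ∑ q ∈ B n (blk n p), u q + V p * u p = f p) ∧
          ∀ (u' : X d → ℝ) (Bu' : ℝ), (∀ p, |u' p| ≤ Bu') →
            (∀ p, ((n : ℝ) + 1) ^ 2 * ∑ μ', (2 * u' p - u' (p + e μ') - u' (p - e μ'))
              + a / ((n : ℝ) + 1) ^ d * ∑ q ∈ B n (blk n p), u' q + V p * u' p = f p) → ∀ p, u' p = u p) ∧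
        (∃ uK : X d → ℝ, (∃ BuK : ℝ, ∀ p, |uK p| ≤ BuK) ∧
          (∀ p, ((n : ℝ) + 1) ^ 2 * ∑ μ', (2 * uK p - uK (p + e μ') - uK (p - e μ'))
            + a / ((n : ℝ) + 1) ^ d * ∑ q ∈ B n (blk n p), uK q + V p * uK p + ∑' q : X d, K p q * uK q = f p) ∧
          ∀ (u' : X d → ℝ) (Bu' : ℝ), (∀ p, |u' p| ≤ Bu') →
            (∀ p, ((n : ℝ) + 1) ^ 2 * ∑ μ', (2 * u' p - u' (p + e μ') - u' (p - e μ'))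
              + a / ((n : ℝ) + 1) ^ d * ∑ q ∈ B n (blk n p), u' q + V p * u' p + ∑' q : X d, K p q * u' q = f p) →
            ∀ p, u' p = uK p) ∧
        -- (ii) profiles, (iii) Lipschitz in `K`, pointwise and for block means
        (∀ (u : X d → ℝ) (Bu : ℝ), (∀ p, |u p| ≤ Bu) →
          (∀ p, ((n : ℝ) + 1) ^ 2 * ∑ μ', (2 * u p - u (p + e μ') - u (p - e μ'))
            + a / ((n : ℝ) + 1) ^ d * ∑ q ∈ B n (blk n p), u q + V p * u p = f p) →
          ∀ (uK : X d → ℝ) (BuK : ℝ), (∀ p, |uK p| ≤ BuK) →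
          (∀ p, ((n : ℝ) + 1) ^ 2 * ∑ μ', (2 * uK p - uK (p + e μ') - uK (p - e μ'))
            + a / ((n : ℝ) + 1) ^ d * ∑ q ∈ B n (blk n p), uK q + V p * uK p + ∑' q : X d, K p q * uK q = f p) →
          (∀ p, |u p| ≤ 2 * (CP * (2 * (1 - exp (-(δ₀ - μ)))⁻¹) ^ d) * Mf * exp (-(μ * ∑ i, (((blk n p i - b₀ i).natAbs : ℕ) : ℝ)))) ∧
          (∀ p, |uK p| ≤ 2 * (CP * (2 * (1 - exp (-(δ₀ - μ)))⁻¹) ^ d) * Mf * exp (-(μ * ∑ i, (((blk n p i - b₀ i).natAbs : ℕ) : ℝ)))) ∧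
          (∀ p, |uK p - u p| ≤ 4 * (CP * (2 * (1 - exp (-(δ₀ - μ)))⁻¹) ^ d)
            * ((CP * (2 * (1 - exp (-(δ₀ - μ)))⁻¹) ^ d) * (ε * exp (μ * d) * (2 * (1 - exp (-(γ - μ)))⁻¹) ^ d)) * Mf
            * exp (-(μ * ∑ i, (((blk n p i - b₀ i).natAbs : ℕ) : ℝ)))) ∧
          (∀ b, |(((n : ℝ) + 1) ^ d)⁻¹ * ∑ q ∈ B n b, uK q - (((n : ℝ) + 1) ^ d)⁻¹ * ∑ q ∈ B n b, u q|
            ≤ 4 * (CP * (2 * (1 - exp (-(δ₀ - μ)))⁻¹) ^ d)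
              * ((CP * (2 * (1 - exp (-(δ₀ - μ)))⁻¹) ^ d) * (ε * exp (μ * d) * (2 * (1 - exp (-(γ - μ)))⁻¹) ^ d)) * Mf
              * exp (-(μ * ∑ i, (((b i - b₀ i).natAbs : ℕ) : ℝ))))) := by
  classical
  obtain ⟨C₀, CP, δ₀, hC₀, hCP, hδ₀, H⟩ := zd_perturbed_profile (d := d) hd a ha hlam hLam
  refine ⟨C₀, CP, δ₀, hC₀, hCP, hδ₀, ?_⟩
  intro n V hV hV' ε γ μ hε hμ hμδ hμγ hsmall1 hsmall2 K hK b₀ Mf f hf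
  have hvol : (0 : ℝ) < ((n : ℝ) + 1) ^ d := by positivity
  have hKδμ : 0 < (2 * (1 - exp (-(δ₀ - μ)))⁻¹) ^ d := pow_pos (mul_pos two_pos (inv_pos.2 (sub_pos.2 (exp_lt_one_iff.2 (by linarith))))) d
  obtain ⟨CPK, hCPK⟩ : ∃ CPK : ℝ, CPK = CP * (2 * (1 - exp (-(δ₀ - μ)))⁻¹) ^ d := ⟨_, rfl⟩
  have hCPK0 : 0 < CPK := by rw [hCPK]; exact mul_pos hCP hKδμ
  rw [← hCPK]
  have hMf : 0 ≤ Mf := by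
    have h1 := (abs_nonneg _).trans (hf 0)
    exact le_of_mul_le_mul_right (by rw [zero_mul]; exact h1) (exp_pos _)
  have hfsup : ∀ q, |f q| ≤ Mf := fun q =>
    (hf q).trans (mul_le_of_le_one_right hMf (exp_le_one_iff.2 (neg_nonpos.2 (by positivity))))
  obtain ⟨⟨GK, hGKeq, hGKuniq⟩, HK⟩ := H n V hV hV' ε γ μ hε hμ hμδ hμγ hsmall1 hsmall2 K hK
  have hK0 : ∀ p q : X d, |(0 : ℝ)| ≤ ε * exp (-(γ * ∑ i, (((p i - q i).natAbs : ℕ) : ℝ))) := fun p q => by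
    rw [abs_zero]; positivity
  obtain ⟨⟨G, hGeq, hGuniq⟩, H0⟩ := H n V hV hV' ε γ μ hε hμ hμδ hμγ hsmall1 hsmall2 (fun _ _ => 0) hK0
  -- the source in `ℓ^∞`
  have hmem : Memℓp f ∞ := memℓp_infty ⟨Mf, by
    rintro _ ⟨q, rfl⟩
    show ‖f q‖ ≤ Mf
    rw [Real.norm_eq_abs]; exact hfsup q⟩
  obtain ⟨fl, hfl⟩ : ∃ fl : lp (fun _ : X d => ℝ) ∞, ∀ q, fl q = f q := ⟨⟨f, hmem⟩, fun _ => rfl⟩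
  -- block means of a profile
  have hmean : ∀ (b : X d) (A : ℝ) (Φ : X d → ℝ), (∀ p, |Φ p| ≤ A * exp (-(μ * ∑ i, (((blk n p i - b₀ i).natAbs : ℕ) : ℝ)))) →
      |(((n : ℝ) + 1) ^ d)⁻¹ * ∑ q ∈ B n b, Φ q| ≤ A * exp (-(μ * ∑ i, (((b i - b₀ i).natAbs : ℕ) : ℝ))) := by
    intro b A Φ hΦ
    rw [abs_mul, abs_inv, abs_of_pos hvol, inv_mul_le_iff₀ hvol]
    calc |∑ q ∈ B n b, Φ q| ≤ ∑ q ∈ B n b, |Φ q| := Finset.abs_sum_le_sum_abs _ _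
      _ ≤ ∑ _q ∈ B n b, A * exp (-(μ * ∑ i, (((b i - b₀ i).natAbs : ℕ) : ℝ))) :=
          Finset.sum_le_sum fun q hq => by have h := hΦ q; rw [mem_B.1 hq] at h; exact h
      _ = _ := sum_B_const _ _
  refine ⟨⟨fun p => G fl p, ⟨‖G fl‖, fun p => abs_apply_le_norm (G fl) p⟩, fun p => ?_, fun u' Bu' hu'B hu' p => ?_⟩,
    ⟨fun p => GK fl p, ⟨‖GK fl‖, fun p => abs_apply_le_norm (GK fl) p⟩, fun p => ?_, fun u' Bu' hu'B hu' p => ?_⟩,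
    fun u Bu huB hu uK BuK huKB huK => ?_⟩
  · have h := hGeq fl p
    simp only [zero_mul, tsum_zero, add_zero] at h
    rw [← hfl]; exact h
  · exact hGuniq fl u' Bu' hu'B (fun q => by simp only [zero_mul, tsum_zero, add_zero]; rw [hfl]; exact hu' q) p
  · rw [← hfl]; exact hGKeq fl p
  · exact hGKuniq fl u' Bu' hu'B (fun q => by rw [hfl]; exact hu' q) p
  · -- (ii): profiles of `u` (zero kernel) and `u^K`
    have hu0 : ∀ p, ((n : ℝ) + 1) ^ 2 * ∑ μ', (2 * u p - u (p + e μ') - u (p - e μ'))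
        + a / ((n : ℝ) + 1) ^ d * ∑ q ∈ B n (blk n p), u q + V p * u p + ∑' q : X d, (0 : ℝ) * u q = f p := fun p => by
      simp only [zero_mul, tsum_zero, add_zero]; exact hu p
    have hdec0 : ∀ p, |u p| ≤ 2 * CPK * Mf * exp (-(μ * ∑ i, (((blk n p i - b₀ i).natAbs : ℕ) : ℝ))) := fun p => by
      have h := H0 b₀ Mf f hf u Bu huB hu0 p
      rw [← hCPK] at h
      exact h
    have hdecK : ∀ p, |uK p| ≤ 2 * CPK * Mf * exp (-(μ * ∑ i, (((blk n p i - b₀ i).natAbs : ℕ) : ℝ))) := fun p => by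
      have h := HK b₀ Mf f hf uK BuK huKB huK p
      rw [← hCPK] at h
      exact h
    -- (iii): `w = u^K − u` solves the perturbed equation with source `−Ku`
    have hstep0 := fun p => kernel_profile_step (d := d) n hε hμ.le hμγ K hK b₀ u hdec0 p
    have hstepK := fun p => kernel_profile_step (d := d) n hε hμ.le hμγ K hK b₀ uK hdecK p
    have hsrc : ∀ p, |-(∑' q : X d, K p q * u q)|
        ≤ ε * exp (μ * d) * (2 * (1 - exp (-(γ - μ)))⁻¹) ^ d * (2 * CPK * Mf)
          * exp (-(μ * ∑ i, (((blk n p i - b₀ i).natAbs : ℕ) : ℝ))) :=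
      fun p => by rw [abs_neg]; exact (hstep0 p).2
    have hw : ∀ p, ((n : ℝ) + 1) ^ 2 * ∑ μ', (2 * (uK p - u p) - (uK (p + e μ') - u (p + e μ')) - (uK (p - e μ') - u (p - e μ')))
        + a / ((n : ℝ) + 1) ^ d * ∑ q ∈ B n (blk n p), (uK q - u q) + V p * (uK p - u p) + ∑' q : X d, K p q * (uK q - u q)
          = -(∑' q : X d, K p q * u q) := by
      intro p
      have e1 : ∑' q : X d, K p q * (uK q - u q) = ∑' q : X d, K p q * uK q - ∑' q : X d, K p q * u q := by
        rw [← (hstepK p).1.tsum_sub (hstep0 p).1]; exact tsum_congr fun q => by ring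
      have e2 : ∑ μ', (2 * (uK p - u p) - (uK (p + e μ') - u (p + e μ')) - (uK (p - e μ') - u (p - e μ')))
          = ∑ μ', (2 * uK p - uK (p + e μ') - uK (p - e μ')) - ∑ μ', (2 * u p - u (p + e μ') - u (p - e μ')) := by
        rw [← Finset.sum_sub_distrib]; exact Finset.sum_congr rfl fun μ' _ => by ring
      have e3 : ∑ q ∈ B n (blk n p), (uK q - u q) = ∑ q ∈ B n (blk n p), uK q - ∑ q ∈ B n (blk n p), u q :=
        Finset.sum_sub_distrib _ _
      rw [e1, e2, e3]
      have h1 := huK p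
      have h2 := hu p
      linear_combination h1 - h2
    have hwB : ∀ p, |uK p - u p| ≤ BuK + Bu := fun p => (abs_sub _ _).trans (add_le_add (huKB p) (huB p))
    have hwdec : ∀ p, |uK p - u p| ≤ 4 * CPK * (CPK * (ε * exp (μ * d) * (2 * (1 - exp (-(γ - μ)))⁻¹) ^ d)) * Mf
        * exp (-(μ * ∑ i, (((blk n p i - b₀ i).natAbs : ℕ) : ℝ))) := by
      intro p
      have h := HK b₀ _ (fun p => -(∑' q : X d, K p q * u q)) hsrc (fun p => uK p - u p) (BuK + Bu) hwB hw p
      rw [← hCPK] at h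
      calc |uK p - u p| ≤ 2 * CPK * (ε * exp (μ * d) * (2 * (1 - exp (-(γ - μ)))⁻¹) ^ d * (2 * CPK * Mf))
            * exp (-(μ * ∑ i, (((blk n p i - b₀ i).natAbs : ℕ) : ℝ))) := h
        _ = _ := by ring
    refine ⟨hdec0, hdecK, hwdec, fun b => ?_⟩
    rw [← mul_sub, ← Finset.sum_sub_distrib]
    exact hmean b _ (fun q => uK q - u q) hwdec

/-! ## §2. Toy -/

/-- Toy (`d = 3`, `a = 1`, `λ = 0`, `Λ = 1`): the three constants exist. -/
example : ∃ C₀ CP δ₀ : ℝ, 0 < C₀ ∧ 0 < CP ∧ 0 < δ₀ :=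
  let ⟨C₀, CP, δ₀, h1, h2, h3, _⟩ := zd_perturbed_solution_lipschitz (d := 3) le_rfl 1 one_pos (lam := 0) (Lam := 1)
    (by rw [min_eq_right (by norm_num : (1 : ℝ) ≤ 2)]; norm_num) zero_le_one
  ⟨C₀, CP, δ₀, h1, h2, h3⟩

end Summit.QuantumFields.BalabanUV.T4Continuum.NE7b.SupZdPerturbedSolutionLipschitz
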